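import Literature.MathematicalPhysics.QuantumFieldTheory.Balaban1983to89.B9Eq343CovariantResolventHolderAdjointRow

/-!
# `Balaban1983to89.B9Eq344CovariantResolventGradientRow` — T. Bałaban, *Propagators for lattice gauge theories in a background field*, Commun. Math. Phys. **99**
# (1985) 389–434 [Balaban1985BackgroundPropagators] Thm 3.1 (3.44) p. 398, *«|(∇_UG′(U)∇\*_Uλ)(x)| ≤ B′₀(ε)(…‖λ‖_ε… + |λ|)»*, FOR THE COVARIANT MASSIVE RESOLVENT:
# **THE `cosh`-WEIGHTED η-SCALE COVARIANT GRADIENT ROW OF `(Δ^η_U + m)⁻¹D*_U` ON η-HÖLDER DATA, ON THE SMALL-FIELD CLASS — PROVED MODULO the flat weighted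
# gradient letter `HflatG` (inhabited at `m = 1`, exponent `½` by `B9Eq344FlatWindowGradientLetter.flatWindowGradientLetter`) and the gradient letter `Hgrad`
# (inhabited on the model by `B9Eq342ResolventGradLetterTower.exists_gradLetter_resolvent`)** — abstract transporters `R`, `S` (`SR = 1`, contractions,
# `‖R − 1‖, ‖S − 1‖ ≤ ε`, longitudinal `‖S(x,μ) − S(x−e_μ,μ)‖ ≤ ε′`), window `2d·t²(cosh a − 1) < m`:
# `‖(D_R((Δ_{RS}+m)⁻¹D*_Sf))(b)‖ ≤ A∇·(F + H)·W_{x₀}(b₋)`, `A∇ = S_G + tεS_ade^a + Θ_∇·(d(tεS_G(1 + e^a) + t²(ε² + ε′)S_ade^a) + tεde^a)`,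
# for data with `‖f(b)‖ ≤ F·W_{x₀}(b₋)` and `‖f(y′,μ) − f(y,μ)‖ ≤ H·W_{x₀}(y)·(d(y,y′)∕ℓ)^β` (`d(y,y′) ≤ ℓ`).  NO bootstrap: by the resolvent identity
# `G_m = G⁰_m − G_m(Δ_{RS} − Δ_1)G⁰_m` the perturbation hits the FLAT solution `z = G⁰_mD*_1f`, and in the NON-DIVERGENCE form
# `(Δ_{RS} − Δ_1)z(x) = −t²Σ_μ[(R_{x,μ} − 1)(z(x+e_μ) − z(x−e_μ)) + ((R−1) + (S−1) + (S(x−e_μ) − S(x)))z(x−e_μ)]` it is SUP data of size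
# `tε·‖D_1z‖ + t²(ε² + ε′)‖z‖` — one gradient letter (`Hgrad`) finishes.  (The divergence-form split `D*_Sq + s` of gen 93 is NOT usable here: `q` is only bounded
# and `∇G∇*` on bounded data costs `log t`.)  NE9 crux-team LEAF PROVER 01, gen 95 — the abstract half of (L2), by which STOREY H's `H3` is re-docked WITHOUT (HLb).

statement-level skeleton of published theorems with citation tags; proofs where landed; nothing here is a claim about the Yang–Mills mass gap

CITATION HEADER (lean-in-tree rule).  Audit cell `pub-balaban`, sub-cell `t4`, BINDER row NE9; filed by NE9 crux-team LEAF PROVER 01 (`b2b-balaban-t4-ne9-formalise-leaf-01`,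
gen 95; bears_on: R4/N22).  Source READ first-hand (`paper:balaban1985-cmp99-background-propagators`, pp. 394–398).  Inputs BY NAME: gen 93's
`B9Eq342CovariantResolventAdjointRow.greenK_eq_sub_greenK_pert` (resolvent identity), `sad_nonneg`, `wt_pos`, `B9Eq342CovariantResolventAdjointRowLetters.
rePos_covLaplaceSiteK_add`, `norm_apply_le_weighted_of_flat_resolvent_covDiv`, `norm_covDiv_sub_covDiv_flat_apply_le`, `B9Eq323KatoDomination.equiv_covLaplaceSiteK_eq_sum`,
`B9Eq342GradientRowNaturalPerturbation.weight_site_(un)shift_le`.  Nothing printed is a hypothesis; `HflatG`, `Hgrad` are DISPLAYED letters with named inhabitants.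

WHAT IS PROVED (sorry-free; proof lane — 0 `def`; letters `Wt`, `Sad`, `Tm` pinned by equations as in gen 93's files).
* §1 `norm_covLaplace_sub_flat_apply_le` — the NON-divergence bound `‖((Δ_{RS} − Δ_1)z)(x)‖ ≤ Σ_μ[tε(‖D_1z(x,μ)‖ + ‖D_1z(x−e_μ,μ)‖) + t²(ε² + ε′)‖z(x−e_μ)‖]`.
* §2 **`gradRow_covariantResolvent_covDiv`** — the displayed row.
HONEST SCOPE.  Abstract transporters; the instantiation on the (T4E) block (`R = R(U)`, `S = R(U⁻¹)`, `t = η⁻¹`, `m = 1`, `ε = 2M_φM_φ′αη`, `ε′` from `_hUgrad`, rate in the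
window, cosh ↔ block decay) is the successor's tower file (pattern gen 93's `B9Eq343ResolventHolderRowTowerOfFlatWindow`).  Constants crude.  NOT summit progress (cell
pub-balaban: NE9 NOT PRINTED ∕ NOT PROVED; «NE9 ⇐ the named binders»; row WALLED ON A MODEL (O-NE9-1; #5 UNRULED); spine PROVED 0∕9; rung (B)+1 finite T⁴ — NOT infinite
volume, NOT mass gap, NOT BetaPertH, NOT Clay).  HONEST DEPENDENCY (cell line): continuum YM on T⁴ ⇐ BetaPertH ∧ nine spine estimates (0/9 proved); BetaPertH ⇐ (D1) ∧ (D4) ∧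
CAP+tail; G-an2-4 gates asym, D1 and NE2/3/4.  NEW file; nothing modified.  Net new unproved facts: 0.
-/

noncomputable section

open scoped InnerProductSpace ComplexConjugate BigOperators

namespace Literature.MathematicalPhysics.QuantumFieldTheory.Balaban1983to89.B9Eq344CovariantResolventGradientRow

open B4Sect5Torus (TSite tdist tdist_nonneg)
open B4TorusKernel.MultiPeriod (circAbs)
open B9SectCLatticeCarrier (Bond bpos btgt shift unshift shift_unshift unshift_shift)
open B9Eq311L2Pairing (WL2)
open B9Eq33CovDerivVector (covDeriv covDiv covDeriv_apply_dir covDiv_apply)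
open B11Eq103H1Complex (SiteL2K BondL2K covDerivL2K covDivL2K covLaplaceSiteK greenK apply_greenK equiv_covDerivL2K equiv_covDivL2K)
open B9Eq323KatoDomination (equiv_covLaplaceSiteK_eq_sum)
open B9Eq342GradientRowNaturalPerturbation (weight_site_shift_le weight_site_unshift_le)
open B9Eq342CovariantResolventAdjointRowLetters (rePos_covLaplaceSiteK_add norm_apply_le_weighted_of_flat_resolvent_covDiv covDiv_sub_covDiv_flat_apply
  norm_covDiv_sub_covDiv_flat_apply_le)
open B9Eq342CovariantResolventAdjointRow (greenK_eq_sub_greenK_pert sad_nonneg wt_pos)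

variable {d : ℕ} {P : Fin d → ℕ} [∀ i, NeZero (P i)] {W : Type*} [NormedAddCommGroup W] [InnerProductSpace ℂ W] [FiniteDimensional ℂ W]
  {c₀ : ℝ} [Fact (0 < c₀)]

/-! ## §1 The non-divergence bound on `(Δ_{RS} − Δ_1)z` -/

omit [∀ i, NeZero (P i)] [FiniteDimensional ℂ W] in
/-- **`(Δ_{RS} − Δ_1)z` POINTWISE** (`SR = 1`): `((Δ_{RS} − Δ_1)z)(x) = −t²•Σ_μ[(R(x,μ) − 1)z(x+e_μ) + (S(x−e_μ,μ) − 1)z(x−e_μ)]`. [folklore]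
[cite: Balaban1985BackgroundPropagators, (3.23) p.394, (3.3) p.391, (3.8) p.392] -/
theorem covLaplace_sub_flat_apply (t : ℝ) (R S : Bond d P → W →ₗ[ℂ] W) (hSR : ∀ b w, S b (R b w) = w) (z : SiteL2K ℂ d P c₀ W) (x : TSite d P) :
    WL2.equiv ℂ _ W (covLaplaceSiteK (t : ℂ) R S z) x - WL2.equiv ℂ _ W (covLaplaceSiteK (t : ℂ) (fun _ : Bond d P => (LinearMap.id : W →ₗ[ℂ] W)) (fun _ => LinearMap.id) z) x =
      -(((t ^ 2 : ℝ) : ℂ) • ∑ μ, ((R (x, μ) (WL2.equiv ℂ _ W z (shift μ x)) - WL2.equiv ℂ _ W z (shift μ x)) +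
        (S (unshift μ x, μ) (WL2.equiv ℂ _ W z (unshift μ x)) - WL2.equiv ℂ _ W z (unshift μ x)))) := by
  have h1 := equiv_covLaplaceSiteK_eq_sum (𝕜 := ℂ) (c₀ := c₀) t R S hSR z x
  have h2 := equiv_covLaplaceSiteK_eq_sum (𝕜 := ℂ) (c₀ := c₀) t (fun _ : Bond d P => (LinearMap.id : W →ₗ[ℂ] W)) (fun _ => LinearMap.id) (fun _ _ => rfl) z x
  rw [RCLike.ofReal_eq_complex_ofReal] at h1 h2
  rw [h1, h2, ← Finset.sum_sub_distrib, Finset.smul_sum, ← Finset.sum_neg_distrib]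
  refine Finset.sum_congr rfl fun μ _ => ?_
  simp only [LinearMap.id_coe, id_eq, smul_add, smul_sub]
  abel

omit [∀ i, NeZero (P i)] [FiniteDimensional ℂ W] in
/-- **THE NON-DIVERGENCE BOUND**: for `SR = 1`, `‖(R−1)w‖, ‖(S−1)w‖ ≤ ε‖w‖`, `‖S(x,μ)w − S(x−e_μ,μ)w‖ ≤ ε′‖w‖`, `t > 0`:
`‖((Δ_{RS} − Δ_1)z)(x)‖ ≤ Σ_μ [tε·(‖(D_1z)(x,μ)‖ + ‖(D_1z)(x−e_μ,μ)‖) + t²(ε² + ε′)·‖z(x−e_μ)‖]`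
(`(R−1)z(x+e_μ) + (S(x−e_μ)−1)z(x−e_μ) = (R−1)(z(x+e_μ) − z(x−e_μ)) − (S−1)(R−1)z(x−e_μ) + (S(x−e_μ) − S(x))z(x−e_μ)`, and
`z(x+e_μ) − z(x−e_μ) = t⁻¹((D_1z)(x,μ) + (D_1z)(x−e_μ,μ))`). [folklore] [cite: Balaban1985BackgroundPropagators, (3.23) p.394, (3.35)–(3.36) p.396] -/
theorem norm_covLaplace_sub_flat_apply_le (t : ℝ) (ht : 0 < t) {ε ε' : ℝ} (hε : 0 ≤ ε) (R S : Bond d P → W →ₗ[ℂ] W) (hSR : ∀ b w, S b (R b w) = w)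
    (hRε : ∀ b w, ‖R b w - w‖ ≤ ε * ‖w‖) (hSε : ∀ b w, ‖S b w - w‖ ≤ ε * ‖w‖)
    (hSε' : ∀ (x : TSite d P) (μ : Fin d) (w : W), ‖S (x, μ) w - S (unshift μ x, μ) w‖ ≤ ε' * ‖w‖)
    (z : SiteL2K ℂ d P c₀ W) (x : TSite d P) :
    ‖WL2.equiv ℂ _ W (covLaplaceSiteK (t : ℂ) R S z) x - WL2.equiv ℂ _ W (covLaplaceSiteK (t : ℂ) (fun _ : Bond d P => (LinearMap.id : W →ₗ[ℂ] W)) (fun _ => LinearMap.id) z) x‖ ≤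
      ∑ μ, (t * ε * (‖WL2.equiv ℂ _ W (covDerivL2K ℂ c₀ (t : ℂ) (fun _ : Bond d P => (LinearMap.id : W →ₗ[ℂ] W)) z) (x, μ)‖ +
          ‖WL2.equiv ℂ _ W (covDerivL2K ℂ c₀ (t : ℂ) (fun _ : Bond d P => (LinearMap.id : W →ₗ[ℂ] W)) z) (unshift μ x, μ)‖) +
        t ^ 2 * (ε ^ 2 + ε') * ‖WL2.equiv ℂ _ W z (unshift μ x)‖) := by
  -- the flat differences
  have hD : ∀ (y : TSite d P) (μ : Fin d), WL2.equiv ℂ _ W (covDerivL2K ℂ c₀ (t : ℂ) (fun _ : Bond d P => (LinearMap.id : W →ₗ[ℂ] W)) z) (y, μ) =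
      (t : ℂ) • (WL2.equiv ℂ _ W z (shift μ y) - WL2.equiv ℂ _ W z y) := fun y μ => by
    rw [equiv_covDerivL2K, covDeriv_apply_dir]; rfl
  rw [covLaplace_sub_flat_apply t R S hSR z x, norm_neg, norm_smul, Complex.norm_real, Real.norm_eq_abs, abs_of_nonneg (by positivity : (0:ℝ) ≤ t ^ 2)]
  set v := WL2.equiv ℂ _ W z with hv
  refine (mul_le_mul_of_nonneg_left (norm_sum_le _ _) (by positivity)).trans ?_
  rw [Finset.mul_sum]
  refine Finset.sum_le_sum fun μ _ => ?_
  -- the algebra: `(R−1)v₊ + (S₋−1)v₋ = (R−1)(v₊ − v₋) − (S−1)((R−1)v₋) + (S₋ − S)v₋`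
  have halg : (R (x, μ) (v (shift μ x)) - v (shift μ x)) + (S (unshift μ x, μ) (v (unshift μ x)) - v (unshift μ x)) =
      (R (x, μ) (v (shift μ x) - v (unshift μ x)) - (v (shift μ x) - v (unshift μ x))) -
        (S (x, μ) (R (x, μ) (v (unshift μ x)) - v (unshift μ x)) - (R (x, μ) (v (unshift μ x)) - v (unshift μ x))) +
        (S (unshift μ x, μ) (v (unshift μ x)) - S (x, μ) (v (unshift μ x))) := by
    rw [map_sub, map_sub, hSR]; abel
  have h1 : ‖R (x, μ) (v (shift μ x) - v (unshift μ x)) - (v (shift μ x) - v (unshift μ x))‖ ≤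
      ε * (t⁻¹ * (‖WL2.equiv ℂ _ W (covDerivL2K ℂ c₀ (t : ℂ) (fun _ : Bond d P => (LinearMap.id : W →ₗ[ℂ] W)) z) (x, μ)‖ +
        ‖WL2.equiv ℂ _ W (covDerivL2K ℂ c₀ (t : ℂ) (fun _ : Bond d P => (LinearMap.id : W →ₗ[ℂ] W)) z) (unshift μ x, μ)‖)) := by
    refine (hRε _ _).trans (mul_le_mul_of_nonneg_left ?_ hε)
    have e : v (shift μ x) - v (unshift μ x) = (t⁻¹ : ℂ) • ((t : ℂ) • (v (shift μ x) - v x)) + (t⁻¹ : ℂ) • ((t : ℂ) • (v (shift μ (unshift μ x)) - v (unshift μ x))) := by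
      rw [shift_unshift, smul_smul, smul_smul, inv_mul_cancel₀ (by exact_mod_cast ht.ne'), one_smul, one_smul]; abel
    rw [e, hD x μ, hD (unshift μ x) μ]
    refine (norm_add_le _ _).trans (le_of_eq ?_)
    simp only [norm_smul, norm_inv, Complex.norm_real, Real.norm_eq_abs, abs_of_pos ht]
    field_simp
  have h2 : ‖S (x, μ) (R (x, μ) (v (unshift μ x)) - v (unshift μ x)) - (R (x, μ) (v (unshift μ x)) - v (unshift μ x))‖ ≤ ε ^ 2 * ‖v (unshift μ x)‖ := by
    calc ‖S (x, μ) (R (x, μ) (v (unshift μ x)) - v (unshift μ x)) - (R (x, μ) (v (unshift μ x)) - v (unshift μ x))‖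
        ≤ ε * ‖R (x, μ) (v (unshift μ x)) - v (unshift μ x)‖ := hSε _ _
      _ ≤ ε * (ε * ‖v (unshift μ x)‖) := mul_le_mul_of_nonneg_left (hRε _ _) hε
      _ = ε ^ 2 * ‖v (unshift μ x)‖ := by ring
  have h3 : ‖S (unshift μ x, μ) (v (unshift μ x)) - S (x, μ) (v (unshift μ x))‖ ≤ ε' * ‖v (unshift μ x)‖ := by
    rw [← norm_neg, neg_sub]; exact hSε' x μ _
  rw [halg]
  calc t ^ 2 * ‖(R (x, μ) (v (shift μ x) - v (unshift μ x)) - (v (shift μ x) - v (unshift μ x))) -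
          (S (x, μ) (R (x, μ) (v (unshift μ x)) - v (unshift μ x)) - (R (x, μ) (v (unshift μ x)) - v (unshift μ x))) +
          (S (unshift μ x, μ) (v (unshift μ x)) - S (x, μ) (v (unshift μ x)))‖
      ≤ t ^ 2 * (ε * (t⁻¹ * (‖WL2.equiv ℂ _ W (covDerivL2K ℂ c₀ (t : ℂ) (fun _ : Bond d P => (LinearMap.id : W →ₗ[ℂ] W)) z) (x, μ)‖ +
          ‖WL2.equiv ℂ _ W (covDerivL2K ℂ c₀ (t : ℂ) (fun _ : Bond d P => (LinearMap.id : W →ₗ[ℂ] W)) z) (unshift μ x, μ)‖)) +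
          ε ^ 2 * ‖v (unshift μ x)‖ + ε' * ‖v (unshift μ x)‖) := by
        apply mul_le_mul_of_nonneg_left _ (by positivity)
        exact (norm_add_le _ _).trans (add_le_add ((norm_sub_le _ _).trans (add_le_add h1 h2)) h3)
    _ = t * ε * (‖WL2.equiv ℂ _ W (covDerivL2K ℂ c₀ (t : ℂ) (fun _ : Bond d P => (LinearMap.id : W →ₗ[ℂ] W)) z) (x, μ)‖ +
          ‖WL2.equiv ℂ _ W (covDerivL2K ℂ c₀ (t : ℂ) (fun _ : Bond d P => (LinearMap.id : W →ₗ[ℂ] W)) z) (unshift μ x, μ)‖) +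
        t ^ 2 * (ε ^ 2 + ε') * ‖v (unshift μ x)‖ := by
        field_simp
        ring

/-! ## §2 The gradient row -/

section Row

variable (t : ℝ) (ht : 0 < t) {m a ε ε' ℓ β : ℝ} (hm : 0 < m) (ha : 0 ≤ a) (hε : 0 ≤ ε) (hε' : 0 ≤ ε')
  (hlam : 2 * (d : ℝ) * t ^ 2 * (Real.cosh a - 1) < m) (hn : ∀ ν, 2 ≤ P ν)
  (R S : Bond d P → W →ₗ[ℂ] W) (hSR : ∀ b w, S b (R b w) = w)
  (hRε : ∀ b w, ‖R b w - w‖ ≤ ε * ‖w‖) (hSε : ∀ b w, ‖S b w - w‖ ≤ ε * ‖w‖)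
  (hSε' : ∀ (x : TSite d P) (μ : Fin d) (w : W), ‖S (x, μ) w - S (unshift μ x, μ) w‖ ≤ ε' * ‖w‖)
  (Wt : TSite d P → TSite d P → ℝ)
  (hWt : ∀ x₀ y, Wt x₀ y = ∏ μ, Real.cosh (a * (circAbs (P μ) ((((x₀ μ : ℕ) : ZMod (P μ)) - ((y μ : ℕ) : ZMod (P μ))).val) : ℝ)))
  (Sad : ℝ)
  (hSad : Sad = t * ∑ ν : Fin d, ((1 + Real.exp (-a)) * ((1 + 2 * t / (P ν * Real.sqrt (m - 2 * ((d : ℝ) - 1) * t ^ 2 * (Real.cosh a - 1)))) /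
            Real.sqrt ((m - 2 * ((d : ℝ) - 1) * t ^ 2 * (Real.cosh a - 1)) ^ 2 + 4 * (m - 2 * ((d : ℝ) - 1) * t ^ 2 * (Real.cosh a - 1)) * t ^ 2)) +
          2 * Real.sinh a / (m - 2 * (d : ℝ) * t ^ 2 * (Real.cosh a - 1))))
  (Tm : SiteL2K ℂ d P c₀ W →ₗ[ℂ] SiteL2K ℂ d P c₀ W) (hTm : Tm = covLaplaceSiteK (t : ℂ) R S + (m : ℂ) • LinearMap.id)
  (hpos : ∀ x : SiteL2K ℂ d P c₀ W, x ≠ 0 → 0 < RCLike.re ⟪x, Tm x⟫_ℂ)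
  -- THE TWO DISPLAYED LETTERS
  (SG : ℝ) (hSG : 0 ≤ SG)
  (HflatG : ∀ (x₀ : TSite d P) (u : SiteL2K ℂ d P c₀ W) (f : BondL2K ℂ d P c₀ W) (F H : ℝ), 0 ≤ F → 0 ≤ H →
    covLaplaceSiteK (t : ℂ) (fun _ : Bond d P => (LinearMap.id : W →ₗ[ℂ] W)) (fun _ => LinearMap.id) u + (m : ℂ) • u =
      covDivL2K ℂ c₀ (t : ℂ) (fun _ : Bond d P => (LinearMap.id : W →ₗ[ℂ] W)) f →
    (∀ b, ‖WL2.equiv ℂ _ W f b‖ ≤ F * Wt x₀ (bpos b)) →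
    (∀ (y y' : TSite d P) (μ : Fin d), tdist P y y' ≤ ℓ → ‖WL2.equiv ℂ _ W f (y', μ) - WL2.equiv ℂ _ W f (y, μ)‖ ≤ H * Wt x₀ y * (tdist P y y' / ℓ) ^ β) →
    ∀ b, ‖WL2.equiv ℂ _ W (covDerivL2K ℂ c₀ (t : ℂ) (fun _ : Bond d P => (LinearMap.id : W →ₗ[ℂ] W)) u) b‖ ≤ SG * (F + H) * Wt x₀ (bpos b))
  (Θg : ℝ) (hΘg : 0 ≤ Θg)
  (Hgrad : ∀ (x₀ : TSite d P) (g : SiteL2K ℂ d P c₀ W) (Gs : ℝ), 0 ≤ Gs → (∀ y, ‖WL2.equiv ℂ _ W g y‖ ≤ Gs * Wt x₀ y) →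
    ∀ b, ‖WL2.equiv ℂ _ W (covDerivL2K ℂ c₀ (t : ℂ) R (greenK Tm hpos g)) b‖ ≤ Θg * Gs * Wt x₀ (bpos b))

include ht hm ha hε hε' hlam hn hSR hRε hSε hSε' hWt hSad hTm hSG HflatG hΘg Hgrad in
/-- **THE `cosh`-WEIGHTED η-SCALE COVARIANT GRADIENT ROW OF `(Δ_{RS}+m)⁻¹D*_S` ON η-HÖLDER DATA** ([B9] Thm 3.1 (3.44)'s shape `∇G∇*` for the covariant massive
resolvent on the small-field class, abstract transporters, MODULO the flat gradient letter `HflatG` and the gradient letter `Hgrad`): for every centre `x₀`, `F, H ≥ 0`,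
bond datum `f` with `‖f(b)‖ ≤ F·W_{x₀}(b₋)` and `‖f(y′,μ) − f(y,μ)‖ ≤ H·W_{x₀}(y)·(d(y,y′)∕ℓ)^β` (`d(y,y′) ≤ ℓ`), and every bond `b`:
`‖(D_R((Δ_{RS}+m)⁻¹D*_Sf))(b)‖ ≤ [S_G + tεS_ade^a + Θ_∇(d(tεS_G(1 + e^a) + t²(ε² + ε′)S_ade^a) + tεde^a)]·(F + H)·W_{x₀}(b₋)`
(`G_mD*_Sf = z − G_m((Δ_{RS} − Δ_1)z) + G_m(D*_Sf − D*_1f)`, `z = G⁰_mD*_1f` FLAT; `D_Rz = D_1z + t(R − 1)z(b₊)`; `HflatG` and the flat value row for `z`;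
`norm_covLaplace_sub_flat_apply_le` makes the middle source sup data; `Hgrad` for the two `G_m`-terms). [cite: Balaban1985BackgroundPropagators, Thm 3.1 (3.44) p.398, (3.23) p.394, (3.35)–(3.36) p.396] -/
theorem gradRow_covariantResolvent_covDiv
    (x₀ : TSite d P) (f : BondL2K ℂ d P c₀ W) (F H : ℝ) (hF : 0 ≤ F) (hH : 0 ≤ H)
    (hf : ∀ b, ‖WL2.equiv ℂ _ W f b‖ ≤ F * Wt x₀ (bpos b))
    (hfH : ∀ (y y' : TSite d P) (μ : Fin d), tdist P y y' ≤ ℓ → ‖WL2.equiv ℂ _ W f (y', μ) - WL2.equiv ℂ _ W f (y, μ)‖ ≤ H * Wt x₀ y * (tdist P y y' / ℓ) ^ β)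
    (b : Bond d P) :
    ‖WL2.equiv ℂ _ W (covDerivL2K ℂ c₀ (t : ℂ) R (greenK Tm hpos (covDivL2K ℂ c₀ (t : ℂ) S f))) b‖ ≤
      (SG + t * ε * Sad * Real.exp a + Θg * (d * (t * ε * SG * (1 + Real.exp a) + t ^ 2 * (ε ^ 2 + ε') * Sad * Real.exp a) + t * ε * d * Real.exp a)) *
        (F + H) * Wt x₀ (bpos b) := by
  have hSad0 : 0 ≤ Sad := sad_nonneg t ht ha hlam Sad hSad
  have hW0 : ∀ y, 0 < Wt x₀ y := wt_pos (a := a) Wt hWt x₀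
  have hEW : ∀ y, 0 ≤ Real.exp a * Wt x₀ y := fun y => mul_nonneg (Real.exp_pos a).le (hW0 y).le
  have hea : 1 ≤ Real.exp a := Real.one_le_exp ha
  have hd0 : (0 : ℝ) ≤ d := Nat.cast_nonneg d
  have hFH : F ≤ F + H := by linarith
  subst hTm
  -- positivity of the flat operator and the objects
  have hRS₁ : ∀ (b : Bond d P) (v u : W), ⟪(fun _ : Bond d P => (LinearMap.id : W →ₗ[ℂ] W)) b v, u⟫_ℂ =
      ⟪v, (fun _ : Bond d P => (LinearMap.id : W →ₗ[ℂ] W)) b u⟫_ℂ := fun _ _ _ => rfl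
  have hpos₁ := rePos_covLaplaceSiteK_add (c₀ := c₀) t hm (fun _ : Bond d P => (LinearMap.id : W →ₗ[ℂ] W)) (fun _ => LinearMap.id) hRS₁
  set Gm := greenK _ hpos with hGm
  set G0 := greenK _ hpos₁ with hG0
  set z : SiteL2K ℂ d P c₀ W := G0 (covDivL2K ℂ c₀ (t : ℂ) (fun _ : Bond d P => (LinearMap.id : W →ₗ[ℂ] W)) f) with hz
  set Vz : SiteL2K ℂ d P c₀ W := covLaplaceSiteK (t : ℂ) R S z - covLaplaceSiteK (t : ℂ) (fun _ : Bond d P => (LinearMap.id : W →ₗ[ℂ] W)) (fun _ => LinearMap.id) z with hVz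
  set Bf : SiteL2K ℂ d P c₀ W := covDivL2K ℂ c₀ (t : ℂ) S f - covDivL2K ℂ c₀ (t : ℂ) (fun _ : Bond d P => (LinearMap.id : W →ₗ[ℂ] W)) f with hBf
  have hdec : Gm (covDivL2K ℂ c₀ (t : ℂ) S f) = z - Gm Vz + Gm Bf := by
    have e1 : covDivL2K ℂ c₀ (t : ℂ) S f = covDivL2K ℂ c₀ (t : ℂ) (fun _ : Bond d P => (LinearMap.id : W →ₗ[ℂ] W)) f + Bf := by rw [hBf]; abel
    have e2 : Gm (covDivL2K ℂ c₀ (t : ℂ) (fun _ : Bond d P => (LinearMap.id : W →ₗ[ℂ] W)) f) = z - Gm Vz := by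
      rw [hGm, hz, hG0, hVz]
      exact greenK_eq_sub_greenK_pert (c₀ := c₀) (t : ℂ) (m : ℂ) R S hpos hpos₁ _
    rw [e1, map_add, e2]
  -- the weights
  have hWt' : ∀ y, Wt x₀ y = ∏ μ, Real.cosh (a * (circAbs (P μ) ((((x₀ μ : ℕ) : ZMod (P μ)) - ((y μ : ℕ) : ZMod (P μ))).val) : ℝ)) := hWt x₀
  have hWs : ∀ (y : TSite d P) (ν : Fin d), Wt x₀ (shift ν y) ≤ Real.exp a * Wt x₀ y := fun y ν => by
    rw [hWt', hWt']; exact weight_site_shift_le ha x₀ y ν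
  have hWu : ∀ (y : TSite d P) (ν : Fin d), Wt x₀ (unshift ν y) ≤ Real.exp a * Wt x₀ y := fun y ν => by
    rw [hWt', hWt']; exact weight_site_unshift_le ha x₀ y ν
  -- `z`: the flat equation, its value row `≤ S_ad·F·W` and its flat gradient letter `≤ S_G(F+H)W`
  have hzeq : covLaplaceSiteK (t : ℂ) (fun _ : Bond d P => (LinearMap.id : W →ₗ[ℂ] W)) (fun _ => LinearMap.id) z + (m : ℂ) • z =
      covDivL2K ℂ c₀ (t : ℂ) (fun _ : Bond d P => (LinearMap.id : W →ₗ[ℂ] W)) f := by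
    simpa only [LinearMap.add_apply, LinearMap.smul_apply, LinearMap.id_apply] using
      apply_greenK hpos₁ (covDivL2K ℂ c₀ (t : ℂ) (fun _ : Bond d P => (LinearMap.id : W →ₗ[ℂ] W)) f)
  have hf' : ∀ b, ‖WL2.equiv ℂ _ W f b‖ ≤ F * ∏ μ, Real.cosh (a * (circAbs (P μ) ((((x₀ μ : ℕ) : ZMod (P μ)) - ((bpos b μ : ℕ) : ZMod (P μ))).val) : ℝ)) :=
    fun b => by rw [← hWt']; exact hf b
  have hzval : ∀ y, ‖WL2.equiv ℂ _ W z y‖ ≤ Sad * F * Wt x₀ y := fun y => by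
    have := norm_apply_le_weighted_of_flat_resolvent_covDiv (P := P) t ht hm ha hlam hn hzeq x₀ hf' y
    rw [← hSad, ← hWt'] at this; exact this
  have hzgrad : ∀ b, ‖WL2.equiv ℂ _ W (covDerivL2K ℂ c₀ (t : ℂ) (fun _ : Bond d P => (LinearMap.id : W →ₗ[ℂ] W)) z) b‖ ≤ SG * (F + H) * Wt x₀ (bpos b) :=
    HflatG x₀ z f F H hF hH hzeq hf hfH
  -- (P1) `D_Rz = D_1z + t(R − 1)z(b₊)`
  have hP1 : ‖WL2.equiv ℂ _ W (covDerivL2K ℂ c₀ (t : ℂ) R z) b‖ ≤ (SG + t * ε * Sad * Real.exp a) * (F + H) * Wt x₀ (bpos b) := by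
    have e : WL2.equiv ℂ _ W (covDerivL2K ℂ c₀ (t : ℂ) R z) b =
        WL2.equiv ℂ _ W (covDerivL2K ℂ c₀ (t : ℂ) (fun _ : Bond d P => (LinearMap.id : W →ₗ[ℂ] W)) z) b +
          (t : ℂ) • (R b (WL2.equiv ℂ _ W z (btgt b)) - WL2.equiv ℂ _ W z (btgt b)) := by
      rw [equiv_covDerivL2K, equiv_covDerivL2K, B9Eq33CovDerivVector.covDeriv_apply, B9Eq33CovDerivVector.covDeriv_apply]
      simp only [LinearMap.id_coe, id_eq, smul_sub]; abel
    rw [e]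
    have h2 : ‖(t : ℂ) • (R b (WL2.equiv ℂ _ W z (btgt b)) - WL2.equiv ℂ _ W z (btgt b))‖ ≤ t * ε * Sad * Real.exp a * (F + H) * Wt x₀ (bpos b) := by
      rw [norm_smul, Complex.norm_real, Real.norm_eq_abs, abs_of_pos ht]
      have h3 : ‖WL2.equiv ℂ _ W z (btgt b)‖ ≤ Sad * F * (Real.exp a * Wt x₀ (bpos b)) := by
        obtain ⟨x, ν⟩ := b
        exact (hzval _).trans (mul_le_mul_of_nonneg_left (hWs x ν) (by positivity))
      have h4 : Sad * F * (Real.exp a * Wt x₀ (bpos b)) ≤ Sad * (F + H) * (Real.exp a * Wt x₀ (bpos b)) :=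
        mul_le_mul_of_nonneg_right (mul_le_mul_of_nonneg_left hFH hSad0) (hEW _)
      calc t * ‖R b (WL2.equiv ℂ _ W z (btgt b)) - WL2.equiv ℂ _ W z (btgt b)‖ ≤ t * (ε * ‖WL2.equiv ℂ _ W z (btgt b)‖) :=
            mul_le_mul_of_nonneg_left (hRε _ _) ht.le
        _ ≤ t * (ε * (Sad * (F + H) * (Real.exp a * Wt x₀ (bpos b)))) :=
            mul_le_mul_of_nonneg_left (mul_le_mul_of_nonneg_left (h3.trans h4) hε) ht.le
        _ = t * ε * Sad * Real.exp a * (F + H) * Wt x₀ (bpos b) := by ring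
    calc ‖WL2.equiv ℂ _ W (covDerivL2K ℂ c₀ (t : ℂ) (fun _ : Bond d P => (LinearMap.id : W →ₗ[ℂ] W)) z) b +
          (t : ℂ) • (R b (WL2.equiv ℂ _ W z (btgt b)) - WL2.equiv ℂ _ W z (btgt b))‖
        ≤ SG * (F + H) * Wt x₀ (bpos b) + t * ε * Sad * Real.exp a * (F + H) * Wt x₀ (bpos b) := (norm_add_le _ _).trans (add_le_add (hzgrad b) h2)
      _ = (SG + t * ε * Sad * Real.exp a) * (F + H) * Wt x₀ (bpos b) := by ring
  -- (P2) the middle source is sup data of size `Gs·W`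
  set Gs : ℝ := d * (t * ε * SG * (1 + Real.exp a) + t ^ 2 * (ε ^ 2 + ε') * Sad * Real.exp a) * (F + H) with hGs
  have hGs0 : 0 ≤ Gs := by positivity
  have hVz : ∀ y, ‖WL2.equiv ℂ _ W Vz y‖ ≤ Gs * Wt x₀ y := by
    intro y
    have h0 : WL2.equiv ℂ _ W Vz y = WL2.equiv ℂ _ W (covLaplaceSiteK (t : ℂ) R S z) y -
        WL2.equiv ℂ _ W (covLaplaceSiteK (t : ℂ) (fun _ : Bond d P => (LinearMap.id : W →ₗ[ℂ] W)) (fun _ => LinearMap.id) z) y := by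
      rw [hVz, WL2.equiv_sub, Pi.sub_apply]
    rw [h0]
    refine (norm_covLaplace_sub_flat_apply_le (c₀ := c₀) t ht hε R S hSR hRε hSε hSε' z y).trans ?_
    have hterm : ∀ μ : Fin d, t * ε * (‖WL2.equiv ℂ _ W (covDerivL2K ℂ c₀ (t : ℂ) (fun _ : Bond d P => (LinearMap.id : W →ₗ[ℂ] W)) z) (y, μ)‖ +
          ‖WL2.equiv ℂ _ W (covDerivL2K ℂ c₀ (t : ℂ) (fun _ : Bond d P => (LinearMap.id : W →ₗ[ℂ] W)) z) (unshift μ y, μ)‖) +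
        t ^ 2 * (ε ^ 2 + ε') * ‖WL2.equiv ℂ _ W z (unshift μ y)‖ ≤
        (t * ε * SG * (1 + Real.exp a) + t ^ 2 * (ε ^ 2 + ε') * Sad * Real.exp a) * (F + H) * Wt x₀ y := by
      intro μ
      have g1 := hzgrad (y, μ)
      have g2 : ‖WL2.equiv ℂ _ W (covDerivL2K ℂ c₀ (t : ℂ) (fun _ : Bond d P => (LinearMap.id : W →ₗ[ℂ] W)) z) (unshift μ y, μ)‖ ≤
          SG * (F + H) * (Real.exp a * Wt x₀ y) := (hzgrad (unshift μ y, μ)).trans (mul_le_mul_of_nonneg_left (hWu y μ) (by positivity))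
      have g3 : ‖WL2.equiv ℂ _ W z (unshift μ y)‖ ≤ Sad * (F + H) * (Real.exp a * Wt x₀ y) :=
        (hzval _).trans ((mul_le_mul_of_nonneg_left (hWu y μ) (by positivity)).trans
          (mul_le_mul_of_nonneg_right (mul_le_mul_of_nonneg_left hFH hSad0) (hEW y)))
      have htε : 0 ≤ t * ε := by positivity
      have ht2 : 0 ≤ t ^ 2 * (ε ^ 2 + ε') := by positivity
      simp only [bpos] at g1
      calc t * ε * (‖WL2.equiv ℂ _ W (covDerivL2K ℂ c₀ (t : ℂ) (fun _ : Bond d P => (LinearMap.id : W →ₗ[ℂ] W)) z) (y, μ)‖ +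
            ‖WL2.equiv ℂ _ W (covDerivL2K ℂ c₀ (t : ℂ) (fun _ : Bond d P => (LinearMap.id : W →ₗ[ℂ] W)) z) (unshift μ y, μ)‖) +
            t ^ 2 * (ε ^ 2 + ε') * ‖WL2.equiv ℂ _ W z (unshift μ y)‖
          ≤ t * ε * (SG * (F + H) * Wt x₀ y + SG * (F + H) * (Real.exp a * Wt x₀ y)) + t ^ 2 * (ε ^ 2 + ε') * (Sad * (F + H) * (Real.exp a * Wt x₀ y)) :=
            add_le_add (mul_le_mul_of_nonneg_left (add_le_add g1 g2) htε) (mul_le_mul_of_nonneg_left g3 ht2)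
        _ = (t * ε * SG * (1 + Real.exp a) + t ^ 2 * (ε ^ 2 + ε') * Sad * Real.exp a) * (F + H) * Wt x₀ y := by ring
    calc ∑ μ : Fin d, (t * ε * (‖WL2.equiv ℂ _ W (covDerivL2K ℂ c₀ (t : ℂ) (fun _ : Bond d P => (LinearMap.id : W →ₗ[ℂ] W)) z) (y, μ)‖ +
            ‖WL2.equiv ℂ _ W (covDerivL2K ℂ c₀ (t : ℂ) (fun _ : Bond d P => (LinearMap.id : W →ₗ[ℂ] W)) z) (unshift μ y, μ)‖) +
          t ^ 2 * (ε ^ 2 + ε') * ‖WL2.equiv ℂ _ W z (unshift μ y)‖)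
        ≤ ∑ _μ : Fin d, (t * ε * SG * (1 + Real.exp a) + t ^ 2 * (ε ^ 2 + ε') * Sad * Real.exp a) * (F + H) * Wt x₀ y := Finset.sum_le_sum fun μ _ => hterm μ
      _ = Gs * Wt x₀ y := by rw [Finset.sum_const, Finset.card_univ, Fintype.card_fin, nsmul_eq_mul, hGs]; ring
  have hP2 : ‖WL2.equiv ℂ _ W (covDerivL2K ℂ c₀ (t : ℂ) R (Gm Vz)) b‖ ≤ Θg * Gs * Wt x₀ (bpos b) := Hgrad x₀ Vz Gs hGs0 hVz b
  -- (P3) the data defect `D*_Sf − D*_1f` is sup data of size `tεde^aF·W`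
  have hBf : ∀ y, ‖WL2.equiv ℂ _ W Bf y‖ ≤ (t * ε * d * Real.exp a * F) * Wt x₀ y := by
    intro y
    have h0 : WL2.equiv ℂ _ W Bf y = covDiv (t : ℂ) S (WL2.equiv ℂ _ W f) y - covDiv (t : ℂ) (fun _ : Bond d P => (LinearMap.id : W →ₗ[ℂ] W)) (WL2.equiv ℂ _ W f) y := by
      rw [hBf, WL2.equiv_sub, Pi.sub_apply, equiv_covDivL2K, equiv_covDivL2K]
    rw [h0]
    refine (norm_covDiv_sub_covDiv_flat_apply_le t S hSε _ y).trans ?_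
    rw [abs_of_pos ht]
    have hsum : ∑ μ : Fin d, ‖WL2.equiv ℂ _ W f (unshift μ y, μ)‖ ≤ d * (F * (Real.exp a * Wt x₀ y)) := by
      calc ∑ μ : Fin d, ‖WL2.equiv ℂ _ W f (unshift μ y, μ)‖ ≤ ∑ _μ : Fin d, F * (Real.exp a * Wt x₀ y) :=
            Finset.sum_le_sum fun μ _ => (hf (unshift μ y, μ)).trans (mul_le_mul_of_nonneg_left (hWu y μ) hF)
        _ = d * (F * (Real.exp a * Wt x₀ y)) := by rw [Finset.sum_const, Finset.card_univ, Fintype.card_fin, nsmul_eq_mul]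
    calc t * (ε * ∑ μ : Fin d, ‖WL2.equiv ℂ _ W f (unshift μ y, μ)‖) ≤ t * (ε * (d * (F * (Real.exp a * Wt x₀ y)))) := by gcongr
      _ = (t * ε * d * Real.exp a * F) * Wt x₀ y := by ring
  have hP3 : ‖WL2.equiv ℂ _ W (covDerivL2K ℂ c₀ (t : ℂ) R (Gm Bf)) b‖ ≤ Θg * (t * ε * d * Real.exp a * F) * Wt x₀ (bpos b) :=
    Hgrad x₀ Bf _ (by positivity) hBf b
  -- assemble
  have hsplit : WL2.equiv ℂ _ W (covDerivL2K ℂ c₀ (t : ℂ) R (Gm (covDivL2K ℂ c₀ (t : ℂ) S f))) b =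
      WL2.equiv ℂ _ W (covDerivL2K ℂ c₀ (t : ℂ) R z) b - WL2.equiv ℂ _ W (covDerivL2K ℂ c₀ (t : ℂ) R (Gm Vz)) b +
        WL2.equiv ℂ _ W (covDerivL2K ℂ c₀ (t : ℂ) R (Gm Bf)) b := by
    rw [hdec, map_add, map_sub, WL2.equiv_add, WL2.equiv_sub]; rfl
  rw [hsplit]
  have hP3' : Θg * (t * ε * d * Real.exp a * F) * Wt x₀ (bpos b) ≤ Θg * (t * ε * d * Real.exp a) * (F + H) * Wt x₀ (bpos b) := by
    have : Θg * (t * ε * d * Real.exp a * F) ≤ Θg * (t * ε * d * Real.exp a) * (F + H) :=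
      calc Θg * (t * ε * d * Real.exp a * F) = Θg * (t * ε * d * Real.exp a) * F := by ring
        _ ≤ Θg * (t * ε * d * Real.exp a) * (F + H) := mul_le_mul_of_nonneg_left hFH (by positivity)
    exact mul_le_mul_of_nonneg_right this (hW0 _).le
  calc ‖WL2.equiv ℂ _ W (covDerivL2K ℂ c₀ (t : ℂ) R z) b - WL2.equiv ℂ _ W (covDerivL2K ℂ c₀ (t : ℂ) R (Gm Vz)) b +
        WL2.equiv ℂ _ W (covDerivL2K ℂ c₀ (t : ℂ) R (Gm Bf)) b‖
      ≤ ‖WL2.equiv ℂ _ W (covDerivL2K ℂ c₀ (t : ℂ) R z) b‖ + ‖WL2.equiv ℂ _ W (covDerivL2K ℂ c₀ (t : ℂ) R (Gm Vz)) b‖ +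
          ‖WL2.equiv ℂ _ W (covDerivL2K ℂ c₀ (t : ℂ) R (Gm Bf)) b‖ := (norm_add_le _ _).trans (add_le_add (norm_sub_le _ _) le_rfl)
    _ ≤ (SG + t * ε * Sad * Real.exp a) * (F + H) * Wt x₀ (bpos b) + Θg * Gs * Wt x₀ (bpos b) + Θg * (t * ε * d * Real.exp a) * (F + H) * Wt x₀ (bpos b) :=
        add_le_add (add_le_add hP1 hP2) (hP3.trans hP3')
    _ = (SG + t * ε * Sad * Real.exp a + Θg * (d * (t * ε * SG * (1 + Real.exp a) + t ^ 2 * (ε ^ 2 + ε') * Sad * Real.exp a) + t * ε * d * Real.exp a)) *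
        (F + H) * Wt x₀ (bpos b) := by rw [hGs]; ring

end Row

end Literature.MathematicalPhysics.QuantumFieldTheory.Balaban1983to89.B9Eq344CovariantResolventGradientRow

end
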